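import Mathlib
import HarnessLib
import Summits.ResolutionOfSingularities.ResolutionOfSingularities.Theorems.WildQuotientsWildQuotientResolutionS1aA1ModelPins

/-!
# S1a — small tools for assembling an X-scheme kill tree from abstract per-move theorems (degrees through a model iso, generation and
# characteristic of a localised polynomial ring, fixed inverses)

[OURS · L1 W4.5c · lead-1 g13; plan-1 CHAIN v10.40 §4 ASSIGNMENT (iv) «a1_killsIn_three»] — NOT statements of the manuscript; counted 0; AI-level work,
weaker than expert review. Crux stmt-ResolutionOfSingularities-17941 `CyclicQuotientFourfolds`, line `s1a-logminvertex` v13 (`stub_reachLowerInFX`).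
Generic algebra, route-independent.

* `algebraMap_mem_chartNodeGrading`, `invSelf_mem_chartNodeGrading`, `map_algebraMap_mem_mapGrading`, `map_invSelf_mem_mapGrading` — degrees of the
  images of bihomogeneous elements of `R^w` and of the inverted cover element in the node grading of a producer chart, read through ANY model iso `Φ`;
* `consIndexEquiv_pair`, `consIndexEquiv_zero_nsmul`, `consIndexEquiv_zero_neg` — index arithmetic;
* `exists_eq_algebraMap_mul_invSelf_pow`, `closure_range_X_invSelf_eq_top` — `k[T_ι][1/h]` is generated by the variables, `h⁻¹` and the constants;
* `nontrivial_away_of_eval_ne_zero`, `charP_away_of_eval_ne_zero` — `k[T_ι][1/h]` is non-trivial of characteristic `p` once `h` does not vanish somewhere;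
* `apply_eq_of_mul_eq_one` — an automorphism fixing a unit fixes its inverse.
-/

set_option linter.dupNamespace false

noncomputable section

open Literature.AlgebraicGeometry.Resolution
open scoped LaurentPolynomial
open MvPolynomial
open Summit.ResolutionOfSingularities.ResolutionOfSingularities.Theorems.WildQuotientResolution.S1
open Summit.ResolutionOfSingularities.ResolutionOfSingularities.Theorems.WildQuotientResolution.S1.CoarseChart
open Summit.ResolutionOfSingularities.ResolutionOfSingularities.Theorems.WildQuotientResolution.S1.ProducerStep
open Summit.ResolutionOfSingularities.ResolutionOfSingularities.Theorems.WildQuotientResolution.S1.ReesBigrading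
open Summit.ResolutionOfSingularities.ResolutionOfSingularities.Theorems.WildQuotientResolution.S1.NodeTransport
open Summit.ResolutionOfSingularities.ResolutionOfSingularities.Theorems.WildQuotientResolution.S1.CobordantTransport
open Summit.ResolutionOfSingularities.ResolutionOfSingularities.Theorems.WildQuotientResolution.S1.BlowupCharts

namespace Summit.ResolutionOfSingularities.ResolutionOfSingularities.Theorems.WildQuotientResolution.S1.FreeModel

universe u

/-! ## Degrees in the node grading of a producer chart, through a model iso -/

section ChartDegrees

variable {m : ℕ} (r : Fin m → ℕ) {B : Type u} [CommRing B] (𝒜 : (Π j : Fin m, ZMod (r j)) → AddSubgroup B) [GradedRing 𝒜] {c : ℕ}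
  (f : Fin c → B) {δ : Fin c → Π j : Fin m, ZMod (r j)} (w : Fin c → ℕ) (hf : ∀ i, f i ∈ 𝒜 (δ i))
  (D : ℕ) (b : ↥(𝒜 0)) (hb : b ∈ (traceFiltration 𝒜 f w).ideal D)

/-- An element of `R^w` of bidegree `e` maps to the node-grading piece `consIndexEquiv r e` of the chart ring. -/
theorem algebraMap_mem_chartNodeGrading {e : ℤ × (Π j : Fin m, ZMod (r j))} {z : ↥(cobordantAlgebra f w)} (hz : z ∈ reesPiece 𝒜 f w e) :
    algebraMap _ (ChartRing 𝒜 f w D b hb) z ∈ chartNodeGrading r 𝒜 f w hf D b hb (consIndexEquiv r e) := by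
  change _ ∈ chartGrading 𝒜 f w hf D b hb ((consIndexEquiv r).symm (consIndexEquiv r e))
  rw [AddEquiv.symm_apply_apply]
  exact algebraMap_mem_chartGrading 𝒜 f w hf D b hb hz

/-- The inverted cover element has node degree `consIndexEquiv r (-D, 0)`. -/
theorem invSelf_mem_chartNodeGrading :
    IsLocalization.Away.invSelf (coverElement 𝒜 f w D b hb) ∈ chartNodeGrading r 𝒜 f w hf D b hb (consIndexEquiv r (-(D : ℤ), 0)) := by
  change _ ∈ chartGrading 𝒜 f w hf D b hb ((consIndexEquiv r).symm (consIndexEquiv r (-(D : ℤ), 0)))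
  rw [AddEquiv.symm_apply_apply]
  exact invSelf_mem_chartGrading 𝒜 f w hf D b hb

variable {Q : Type u} [CommRing Q] (Φ : ChartRing 𝒜 f w D b hb ≃+* Q)

/-- ★ **Degrees through a model iso**: `Φ (z/1)` lies in the transported piece `consIndexEquiv r e` for `z` of bidegree `e`. -/
theorem map_algebraMap_mem_mapGrading {e : ℤ × (Π j : Fin m, ZMod (r j))} {z : ↥(cobordantAlgebra f w)} (hz : z ∈ reesPiece 𝒜 f w e) :
    Φ (algebraMap _ (ChartRing 𝒜 f w D b hb) z) ∈ mapGrading (chartNodeGrading r 𝒜 f w hf D b hb) Φ (consIndexEquiv r e) := by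
  rw [map_mem_mapGrading_iff]
  exact algebraMap_mem_chartNodeGrading r 𝒜 f w hf D b hb hz

/-- ★ `Φ (c⁻¹)` lies in the transported piece `consIndexEquiv r (-D, 0)`. -/
theorem map_invSelf_mem_mapGrading :
    Φ (IsLocalization.Away.invSelf (coverElement 𝒜 f w D b hb)) ∈ mapGrading (chartNodeGrading r 𝒜 f w hf D b hb) Φ (consIndexEquiv r (-(D : ℤ), 0)) := by
  rw [map_mem_mapGrading_iff]
  exact invSelf_mem_chartNodeGrading r 𝒜 f w hf D b hb

omit [GradedRing 𝒜] in
/-- `consIndexEquiv r (n, δ) = n • consIndexEquiv r (1, 0) + consIndexEquiv r (0, δ)`. -/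
theorem consIndexEquiv_pair (n : ℤ) (δ' : Π j : Fin m, ZMod (r j)) :
    consIndexEquiv r (n, δ') = n • consIndexEquiv r ((1 : ℤ), 0) + consIndexEquiv r ((0 : ℤ), δ') := by
  rw [← consIndexEquiv_int_zero, ← map_add]
  congr 1
  ext <;> simp

omit [GradedRing 𝒜] in
/-- `consIndexEquiv r (0, n • δ) = n • consIndexEquiv r (0, δ)`. -/
theorem consIndexEquiv_zero_nsmul (n : ℕ) (δ' : Π j : Fin m, ZMod (r j)) :
    consIndexEquiv r ((0 : ℤ), n • δ') = n • consIndexEquiv r ((0 : ℤ), δ') := by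
  rw [← map_nsmul]
  congr 1

omit [GradedRing 𝒜] in
/-- `consIndexEquiv r (0, -δ) = -consIndexEquiv r (0, δ)`. -/
theorem consIndexEquiv_zero_neg (δ' : Π j : Fin m, ZMod (r j)) :
    consIndexEquiv r ((0 : ℤ), -δ') = -consIndexEquiv r ((0 : ℤ), δ') := by
  rw [← map_neg]
  congr 1

end ChartDegrees

/-! ## Generation, non-triviality and characteristic of `k[T_ι][1/h]` -/

section AwayGen

variable (k : Type) [CommRing k] {ι : Type} (hh : MvPolynomial ι k)

/-- Every element of `A[1/x]` is `a · (x⁻¹)ⁿ`. [folklore] -/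
theorem exists_eq_algebraMap_mul_invSelf_pow {A : Type u} [CommRing A] (x : A) (z : Localization.Away x) :
    ∃ (a : A) (n : ℕ), z = algebraMap A (Localization.Away x) a * IsLocalization.Away.invSelf x ^ n := by
  obtain ⟨n, a, h⟩ := IsLocalization.Away.surj x z
  refine ⟨a, n, ?_⟩
  calc z = z * (algebraMap A (Localization.Away x) x * IsLocalization.Away.invSelf x) ^ n := by rw [IsLocalization.Away.mul_invSelf, one_pow, mul_one]
    _ = z * algebraMap A (Localization.Away x) x ^ n * IsLocalization.Away.invSelf x ^ n := by rw [mul_pow, mul_assoc]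
    _ = algebraMap A (Localization.Away x) a * IsLocalization.Away.invSelf x ^ n := by rw [h]

/-- ★ **`k[T_ι][1/h]` is generated by the variables, `h⁻¹` and the constants.** [folklore] -/
theorem closure_range_X_invSelf_eq_top :
    Subring.closure (Set.range (fun o : ι => algebraMap (MvPolynomial ι k) (Localization.Away hh) (X o)) ∪
      ({IsLocalization.Away.invSelf hh} ∪ Set.range (algebraMap k (Localization.Away hh)))) = ⊤ := by
  set S := Subring.closure (Set.range (fun o : ι => algebraMap (MvPolynomial ι k) (Localization.Away hh) (X o)) ∪
      ({IsLocalization.Away.invSelf hh} ∪ Set.range (algebraMap k (Localization.Away hh)))) with hS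
  have hP : ∀ z : MvPolynomial ι k, algebraMap (MvPolynomial ι k) (Localization.Away hh) z ∈ S := by
    intro z
    induction z using MvPolynomial.induction_on with
    | C a =>
      refine Subring.subset_closure (Or.inr (Or.inr ⟨a, ?_⟩))
      rw [IsScalarTower.algebraMap_apply k (MvPolynomial ι k) (Localization.Away hh) a, MvPolynomial.algebraMap_eq]
    | add p q hp hq => rw [map_add]; exact add_mem hp hq
    | mul_X p i hp =>
      rw [map_mul]
      exact mul_mem hp (Subring.subset_closure (Or.inl ⟨i, rfl⟩))
  refine top_le_iff.mp fun z _ => ?_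
  obtain ⟨a, n, rfl⟩ := exists_eq_algebraMap_mul_invSelf_pow hh z
  have hinv : IsLocalization.Away.invSelf hh ∈ S :=
    Subring.subset_closure (Set.mem_union_right _ (Set.mem_union_left _ (Set.mem_singleton _)))
  exact Subring.mul_mem S (hP a) (Subring.pow_mem S hinv n)

/-- `k[T_ι][1/h]` is non-trivial as soon as `h(g) ≠ 0` for some point `g` (then `k[T_ι][1/h] → k` exists). [folklore] -/
theorem nontrivial_away_of_eval_ne_zero {K : Type} [Field K] (h : MvPolynomial ι K) (g : ι → K) (hu : MvPolynomial.eval g h ≠ 0) :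
    Nontrivial (Localization.Away h) :=
  RingHom.domain_nontrivial (IsLocalization.Away.lift h (g := MvPolynomial.eval g) (Ne.isUnit hu))

/-- `k[T_ι][1/h]` has the characteristic of `k` as soon as `h(g) ≠ 0` for some point `g`. [folklore] -/
theorem charP_away_of_eval_ne_zero {K : Type} [Field K] (p : ℕ) [CharP K p] (h : MvPolynomial ι K) (g : ι → K) (hu : MvPolynomial.eval g h ≠ 0) :
    CharP (Localization.Away h) p := by
  haveI := nontrivial_away_of_eval_ne_zero h g hu
  exact charP_of_injective_ringHom (algebraMap K (Localization.Away h)).injective p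

end AwayGen

/-! ## Fixed units have fixed inverses -/

/-- An automorphism fixing a unit fixes its inverse. [folklore] -/
theorem apply_eq_of_mul_eq_one {Q : Type u} [CommRing Q] (τ : Q ≃+* Q) {x y : Q} (hxy : x * y = 1) (hx : τ x = x) : τ y = y :=
  calc τ y = τ y * (x * y) := by rw [hxy, mul_one]
    _ = τ (x * y) * y := by rw [map_mul, hx]; ring
    _ = y := by rw [hxy, map_one, one_mul]

end Summit.ResolutionOfSingularities.ResolutionOfSingularities.Theorems.WildQuotientResolution.S1.FreeModel

end
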